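import Literature.AlgebraicGeometry.Frobenioids.PerfectionEndomorphisms
import Literature.AlgebraicGeometry.Frobenioids.FrTrFrobenioid
import Literature.AlgebraicGeometry.Frobenioids.Prop55Sub
import HarnessLib

/-!
# Frobenioids I, Proposition 5.5 (i) for a Frobenius-trivial object: `O^▷(A)^pf ⥲ O^▷(A^pf)`

Mochizuki, *The geometry of Frobenioids I: the general theory*, Kyushu J. Math. **62** (2008)
293–400, Proposition 5.5 (i) p. 104 and its proof p. 104 ll. 46–48: "Assertion (i) follows immediately
for Frobenius-trivial `A` by considering base-identity endomorphisms of Frobenius type of `A` and applying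
the hypothesis that `C` is of Frobenius-normalized type" [cite: MochizukiFrdI2008, Prop. 5.5 (i) p.104].

Sub-node FrdI:Prop5.5(i)/P55-L01 (`PerfectionUnitsIsoFrTriv`) of the cell's SUBDAG-FrdI-Thm51iv-Prop55, for
THE perfection `PreFrobenioidData.perfection hF` (`Perfection*.lean`).  Standing data: a Frobenioid
`F : C ⥤ ElemFrobenioid Φ` (`hF`), an object `A` with a Frobenius-trivial structure
`ζ : N_{≥1} → End_C(A)` (Def. 1.2 (iv): a section of `deg_Fr` by base-identity endomorphisms of Frobenius
type) which is Frobenius-normalized (Def. 1.2 (iv): `α^d ∘ φ = φ ∘ α` for base-identity `φ` of Frobenius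
degree `d` and `α ∈ O^▷(A)`).

The printed argument, made explicit.  By Def. 1.3 (ii) the chosen Frobenius power `A^{(n)}` is identified
with the codomain `A` of `ζ(n)` (`rootIso`, the unique isomorphism under `A`); under these identifications
the transition morphism `A^{(n)} → A^{(n·d)}` is `ζ(d)` (`frobTrans_eq_rootIso`), so the transport
(Prop. 1.10 (i)) of an endomorphism `α ∈ O^▷(A)` from level `n` to level `n·d` is its conjugate through
`ζ(d)`, which by Frobenius-normalization is `α^d` (`liftLevel_rootConj`).  Hence the inductive system
`O^▷(A^{(c)})` computing `O^▷((A, 1))` (`PerfectionEndomorphisms.lean`) is the system `(O^▷(A), α ↦ α^{c'/c})`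
whose limit is the perfection `O^▷(A)^pf` (§0 p. 11): the maps `α^{1/n} ↦ [(n, n), j_n α j_n⁻¹]` assemble
to an isomorphism of monoids `O^▷(A)^pf ⥲ O^▷(A^pf)` (`endPerfectionEquiv`) sending the class of `α` to
the image of `α` under `C → C^pf` (`endPerfectionEquiv_of`).  Isotropy of `A` is not used for this case.
`O^▷(A)` carries the commutative-monoid structure `PreFrobenioid.endCommMonoid F hF A` of `Prop55Sub.lean` (Remark 1.3.1);
the closed form `prop55i_of_isFrobeniusTrivial` has exactly the shape of the slot `FrdI.Prop55Sub.Prop55i`.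
-/

namespace Literature.AlgebraicGeometry.Frobenioids

namespace PreFrobenioid

namespace Perfection

open CategoryTheory Opposite

universe w v v' u u'

variable {D : Type u} [Category.{v} D] {Φ : Dᵒᵖ ⥤ CommMonCat.{w}}
  {C : Type u'} [Category.{v'} C] {F : C ⥤ ElemFrobenioid Φ} (hF : IsFrobenioid F) {A : C}
  (ζ : ℕ+ →* End A)
  (hζ : ∀ n : ℕ+, degFr F (ζ n) = n ∧ IsBaseIdentity F (ζ n) ∧ IsFrobeniusType F (ζ n))

/-! ### The Frobenius powers of a Frobenius-trivial object -/

/-- `A^{(n)} ≅ A` under `A`: the chosen Frobenius power of degree `n` versus the codomain `A` of the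
Frobenius endomorphism `ζ(n)` (Def. 1.3 (ii), essential uniqueness). [cite: MochizukiFrdI2008, Def. 1.3 (ii) p.24] -/
noncomputable def rootIso (n : ℕ+) : frobPow hF A n ≅ A :=
  (hF.ii_unique (frob hF A n) (End.asHom (ζ n)) (isFrobeniusType_frob hF A n) (hζ n).2.2
    ((degFr_frob hF A n).trans (hζ n).1.symm)).choose

/-- `frob_n ≫ rootIso_n = ζ(n)`. [cite: MochizukiFrdI2008, Def. 1.3 (ii) p.24] -/
theorem frob_rootIso_hom (n : ℕ+) : frob hF A n ≫ (rootIso hF ζ hζ n).hom = End.asHom (ζ n) :=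
  (hF.ii_unique (frob hF A n) (End.asHom (ζ n)) (isFrobeniusType_frob hF A n) (hζ n).2.2
    ((degFr_frob hF A n).trans (hζ n).1.symm)).choose_spec

/-- `ζ(n) ≫ ζ(d) = ζ(n·d)` as arrows. [cite: MochizukiFrdI2008, Def. 1.2 (iv) p.22] -/
theorem zeta_comp_zeta (n d : ℕ+) : End.asHom (ζ n) ≫ End.asHom (ζ d) = End.asHom (ζ (n * d)) := by
  rw [mul_comm, map_mul]
  rfl

/-- Under the identifications `rootIso`, the transition morphism `A^{(n)} → A^{(n·d)}` is `ζ(d)`.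
[cite: MochizukiFrdI2008, Def. 3.1 (ii) p.56] -/
theorem frobTrans_eq_rootIso {n n' : ℕ+} (d : ℕ+) (hd : n' = n * d) (h : n ∣ n') :
    frobTrans hF A h = (rootIso hF ζ hζ n).hom ≫ End.asHom (ζ d) ≫ (rootIso hF ζ hζ n').inv := by
  subst hd
  refine (frobTrans_unique hF A h ?_).symm
  rw [← Category.assoc, frob_rootIso_hom, ← Category.assoc, zeta_comp_zeta, ← frob_rootIso_hom hF ζ hζ (n * d),
    Category.assoc, Iso.hom_inv_id, Category.comp_id]

/-- Conjugation `End_C(A) → End_C(A^{(n)})`, `α ↦ rootIso ≫ α ≫ rootIso⁻¹`, as a homomorphism of monoids.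
[cite: MochizukiFrdI2008, Prop. 5.5 (i) p.104] -/
noncomputable def rootConj (n : ℕ+) : End A →* End (frobPow hF A n) := endConj (rootIso hF ζ hζ n).symm

/-- `rootConj n α = rootIso ≫ α ≫ rootIso⁻¹`. [cite: MochizukiFrdI2008, Prop. 5.5 (i) p.104] -/
theorem rootConj_apply (n : ℕ+) (α : End A) :
    End.asHom (rootConj hF ζ hζ n α) = (rootIso hF ζ hζ n).hom ≫ End.asHom α ≫ (rootIso hF ζ hζ n).inv := rfl

/-- `rootConj` is injective (conjugation by an isomorphism). [cite: MochizukiFrdI2008, Prop. 5.5 (i) p.104] -/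
theorem rootConj_injective (n : ℕ+) : Function.Injective (rootConj hF ζ hζ n) := by
  intro α β h
  have h' : (rootIso hF ζ hζ n).inv ≫ End.asHom (rootConj hF ζ hζ n α) ≫ (rootIso hF ζ hζ n).hom =
      (rootIso hF ζ hζ n).inv ≫ End.asHom (rootConj hF ζ hζ n β) ≫ (rootIso hF ζ hζ n).hom := by rw [h]
  simp only [rootConj_apply, Category.assoc, Iso.inv_hom_id_assoc, Iso.inv_hom_id, Category.comp_id] at h'
  exact h'

/-- `rootConj` maps `O^▷(A)` into `O^▷(A^{(n)})`. [cite: MochizukiFrdI2008, Prop. 5.5 (i) p.104] -/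
theorem rootConj_mem (n : ℕ+) {α : End A} (hα : α ∈ endSubmonoid F A) :
    rootConj hF ζ hζ n α ∈ endSubmonoid F (frobPow hF A n) :=
  endConj_mem F (rootIso hF ζ hζ n).symm hα

/-! ### Frobenius-normalization: transport between levels is raising to a power -/

/-- **The printed step.**  For `A` Frobenius-normalized and `α ∈ O^▷(A)`, the Prop. 1.10 (i) transport of
`rootIso ≫ α ≫ rootIso⁻¹` from level `n` to level `n·d` is `rootIso ≫ α^d ≫ rootIso⁻¹`: the transition is
`ζ(d)` and `ζ(d) ∘ α = α^d ∘ ζ(d)`. [cite: MochizukiFrdI2008, Prop. 5.5 (i) p.104] -/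
theorem liftLevel_rootConj (hn : IsFrobeniusNormalized F A) {n n' : ℕ+} (d : ℕ+) (hd : n' = n * d)
    (h : n ∣ n') {α : End A} (hα : α ∈ endSubmonoid F A)
    (hdeg : degFr F (frobTrans hF A h) = degFr F (frobTrans hF A h)) :
    liftLevel hF (End.asHom (rootConj hF ζ hζ n α)) h h hdeg = End.asHom (rootConj hF ζ hζ n' (α ^ (d : ℕ))) := by
  symm
  apply liftLevel_unique
  have key : End.asHom (ζ d) ≫ End.asHom (α ^ (d : ℕ)) = End.asHom α ≫ End.asHom (ζ d) := by
    have := hn (End.asHom (ζ d)) (hζ d).2.1 α hα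
    rw [(hζ d).1] at this
    exact this
  rw [frobTrans_eq_rootIso hF ζ hζ d hd h, rootConj_apply, rootConj_apply]
  simp only [Category.assoc, Iso.inv_hom_id_assoc]
  rw [← Category.assoc (End.asHom (ζ d)), key, Category.assoc]

variable (X : Perfection hF)

/-! ### The level-`n` maps `O^▷(A) → O^▷((A, 1))` -/

/-- The level-`n` map `O^▷(A) → O^▷((A, 1))`, `α ↦ [(n, n), rootIso ≫ α ≫ rootIso⁻¹]` (the element
"`α^{1/n}`" of `O^▷(A^pf)`), a homomorphism of monoids. [cite: MochizukiFrdI2008, Prop. 5.5 (i) p.104] -/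
noncomputable def rootLevelHom (n : ℕ+) : endSubmonoid F A →* (ops hF).endSubmonoid (root hF A 1) :=
  (endSubmonoidClassHom (root hF A 1) n).comp (endSubmonoidConj F (rootIso hF ζ hζ n).symm).toMonoidHom

/-- The underlying endomorphism of `rootLevelHom n α` is the class `[(n, n), rootConj n α]`.
[cite: MochizukiFrdI2008, Prop. 5.5 (i) p.104] -/
theorem rootLevelHom_coe (n : ℕ+) (α : endSubmonoid F A) :
    (rootLevelHom hF ζ hζ n α).1 = endClassHom (root hF A 1) n (rootConj hF ζ hζ n α.1) := rfl

/-- For `A` Frobenius-normalized the level maps are compatible with powers: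
`rootLevelHom n α = rootLevelHom (n·d) (α^d)` ("`α^{1/n} = (α^d)^{1/(nd)}`").
[cite: MochizukiFrdI2008, Prop. 5.5 (i) p.104] -/
theorem rootLevelHom_eq_pow (hn : IsFrobeniusNormalized F A) {n n' : ℕ+} (d : ℕ+) (hd : n' = n * d)
    (α : endSubmonoid F A) : rootLevelHom hF ζ hζ n α = rootLevelHom hF ζ hζ n' (α ^ (d : ℕ)) := by
  apply Subtype.ext
  rw [rootLevelHom_coe, rootLevelHom_coe, SubmonoidClass.coe_pow,
    ← endClassHom_liftLevel (root hF A 1) (⟨d, hd⟩ : n ∣ n') (rootConj hF ζ hζ n α.1) rfl]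
  congr 1
  exact liftLevel_rootConj hF ζ hζ hn d hd ⟨d, hd⟩ α.2 rfl

/-- The level maps are injective up to torsion: `rootLevelHom n α = rootLevelHom n β` forces `α^d = β^d` for
some `d ≥ 1`. [cite: MochizukiFrdI2008, Prop. 5.5 (i) p.104] -/
theorem exists_pow_eq_of_rootLevelHom_eq (hn : IsFrobeniusNormalized F A) {n : ℕ+} {α β : endSubmonoid F A}
    (h : rootLevelHom hF ζ hζ n α = rootLevelHom hF ζ hζ n β) : ∃ d : ℕ+, α ^ (d : ℕ) = β ^ (d : ℕ) := by
  have h' := congrArg Subtype.val h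
  rw [rootLevelHom_coe, rootLevelHom_coe, endClassHom_eq_iff] at h'
  obtain ⟨c, hc, hc', e⟩ := h'
  obtain ⟨d, hd⟩ := hc
  refine ⟨d, Subtype.ext (rootConj_injective hF ζ hζ c ?_)⟩
  rw [SubmonoidClass.coe_pow, SubmonoidClass.coe_pow]
  have e₁ := liftLevel_rootConj hF ζ hζ hn d hd ⟨d, hd⟩ α.2 rfl
  have e₂ := liftLevel_rootConj hF ζ hζ hn d hd ⟨d, hd⟩ β.2 rfl
  exact (e₁.symm.trans e).trans e₂

/-- Every element of `O^▷((A, 1))` is in the image of some level map. [cite: MochizukiFrdI2008, Prop. 5.5 (i) p.104] -/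
theorem exists_rootLevelHom_eq (f : (ops hF).endSubmonoid (root hF A 1)) :
    ∃ (n : ℕ+) (α : endSubmonoid F A), rootLevelHom hF ζ hζ n α = f := by
  obtain ⟨c, θ, rfl⟩ := exists_endSubmonoidClassHom_eq (root hF A 1) f
  refine ⟨c, (endSubmonoidConj F (rootIso hF ζ hζ c).symm).symm θ, ?_⟩
  change endSubmonoidClassHom (root hF A 1) c
      (endSubmonoidConj F (rootIso hF ζ hζ c).symm ((endSubmonoidConj F (rootIso hF ζ hζ c).symm).symm θ)) = _
  rw [MulEquiv.apply_symm_apply]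

/-- At level `1` the level map is `C → C^pf`: `rootLevelHom 1 α = toPf(α)` (`ζ(1) = id`).
[cite: MochizukiFrdI2008, Prop. 5.5 (i) p.104] -/
theorem rootLevelHom_one_coe (α : endSubmonoid F A) :
    (rootLevelHom hF ζ hζ 1 α).1 = End.of ((toPf hF).map (End.asHom α.1)) := by
  rw [rootLevelHom_coe, endClassHom_apply]
  have h1 : frob hF A 1 ≫ (rootIso hF ζ hζ 1).hom = 𝟙 A := by
    rw [frob_rootIso_hom, map_one]
    rfl
  refine congrArg End.of (endClass_one_eq_toPf_map (hF := hF) (End.asHom α.1) _ ?_)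
  change frob hF A 1 ≫ (rootIso hF ζ hζ 1).hom ≫ End.asHom α.1 ≫ (rootIso hF ζ hζ 1).inv =
    End.asHom α.1 ≫ frob hF A 1
  rw [← Category.assoc, h1, Category.id_comp]
  have h2 : frob hF A 1 = (rootIso hF ζ hζ 1).inv := by
    rw [← Category.comp_id (frob hF A 1), ← (rootIso hF ζ hζ 1).hom_inv_id, ← Category.assoc, h1,
      Category.id_comp]
  rw [h2]

/-! ### The isomorphism `O^▷(A)^pf ⥲ O^▷((A, 1))` -/

/-- The map `O^▷(A)^pf → O^▷((A, 1))`, `α^{1/n} ↦ [(n, n), rootIso ≫ α ≫ rootIso⁻¹]`, well defined on the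
perfection by `rootLevelHom_eq_pow`, as a homomorphism of monoids. [cite: MochizukiFrdI2008, Prop. 5.5 (i) p.104] -/
noncomputable def endPerfectionHom (hn : IsFrobeniusNormalized F A) :
    @Frobenioids.Perfection (endSubmonoid F A) (endCommMonoid F hF A) →* (ops hF).endSubmonoid (root hF A 1) :=
  letI := endCommMonoid F hF A
  { toFun := Quotient.lift (fun x : endSubmonoid F A × ℕ+ => rootLevelHom hF ζ hζ x.2 x.1) (by
      rintro ⟨α, n⟩ ⟨β, m⟩ ⟨N, hN⟩
      dsimp only at hN ⊢
      rw [rootLevelHom_eq_pow hF ζ hζ hn (m * N) (show n * m * N = n * (m * N) from mul_assoc _ _ _) α,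
        rootLevelHom_eq_pow hF ζ hζ hn (n * N) (show n * m * N = m * (n * N) by
          rw [← mul_assoc, mul_comm m n]) β]
      congr 1
      rw [PNat.mul_coe, PNat.mul_coe, mul_comm (m : ℕ), mul_comm (n : ℕ), hN])
    map_one' := by
      change rootLevelHom hF ζ hζ 1 1 = 1
      exact map_one _
    map_mul' := by
      rintro ⟨⟨α, n⟩⟩ ⟨⟨β, m⟩⟩
      change rootLevelHom hF ζ hζ (n * m) (α ^ (m : ℕ) * β ^ (n : ℕ)) =
        rootLevelHom hF ζ hζ n α * rootLevelHom hF ζ hζ m β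
      rw [map_mul, rootLevelHom_eq_pow hF ζ hζ hn m rfl α, rootLevelHom_eq_pow hF ζ hζ hn n (mul_comm n m) β] }

/-- `endPerfectionHom` on classes: `α^{1/n} ↦ rootLevelHom n α`. [cite: MochizukiFrdI2008, Prop. 5.5 (i) p.104] -/
theorem endPerfectionHom_mk (hn : IsFrobeniusNormalized F A) (α : endSubmonoid F A) (n : ℕ+) :
    endPerfectionHom hF ζ hζ hn (@Frobenioids.Perfection.mk _ (endCommMonoid F hF A) α n) =
      rootLevelHom hF ζ hζ n α := rfl

/-- `endPerfectionHom` is injective. [cite: MochizukiFrdI2008, Prop. 5.5 (i) p.104] -/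
theorem endPerfectionHom_injective (hn : IsFrobeniusNormalized F A) :
    Function.Injective (endPerfectionHom hF ζ hζ hn) := by
  letI := endCommMonoid F hF A
  intro x y hxy
  obtain ⟨⟨α, n⟩, rfl⟩ := Frobenioids.Perfection.mk_surjective x
  obtain ⟨⟨β, m⟩, rfl⟩ := Frobenioids.Perfection.mk_surjective y
  dsimp only at hxy ⊢
  rw [endPerfectionHom_mk, endPerfectionHom_mk, rootLevelHom_eq_pow hF ζ hζ hn m rfl α,
    rootLevelHom_eq_pow hF ζ hζ hn n (mul_comm n m) β] at hxy
  obtain ⟨d, hd⟩ := exists_pow_eq_of_rootLevelHom_eq hF ζ hζ hn hxy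
  refine Frobenioids.Perfection.mk_eq_mk_iff.mpr ⟨d, ?_⟩
  rw [← pow_mul, ← pow_mul] at hd
  rw [mul_comm (d : ℕ), mul_comm (d : ℕ), hd]

/-- `endPerfectionHom` is surjective. [cite: MochizukiFrdI2008, Prop. 5.5 (i) p.104] -/
theorem endPerfectionHom_surjective (hn : IsFrobeniusNormalized F A) :
    Function.Surjective (endPerfectionHom hF ζ hζ hn) := by
  letI := endCommMonoid F hF A
  intro f
  obtain ⟨n, α, rfl⟩ := exists_rootLevelHom_eq hF ζ hζ f
  exact ⟨Frobenioids.Perfection.mk α n, rfl⟩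

/-- **Proposition 5.5 (i) for a Frobenius-trivial, Frobenius-normalized object**: the isomorphism of monoids
`O^▷(A)^pf ⥲ O^▷(A^pf)`, `A^pf = (A, 1)`, for THE perfection `C^pf`. [cite: MochizukiFrdI2008, Prop. 5.5 (i) p.104] -/
noncomputable def endPerfectionEquiv (hn : IsFrobeniusNormalized F A) :
    @Frobenioids.Perfection (endSubmonoid F A) (endCommMonoid F hF A) ≃* (ops hF).endSubmonoid (root hF A 1) :=
  MulEquiv.ofBijective (endPerfectionHom hF ζ hζ hn)
    ⟨endPerfectionHom_injective hF ζ hζ hn, endPerfectionHom_surjective hF ζ hζ hn⟩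

/-- `endPerfectionEquiv` on classes. [cite: MochizukiFrdI2008, Prop. 5.5 (i) p.104] -/
theorem endPerfectionEquiv_mk (hn : IsFrobeniusNormalized F A) (α : endSubmonoid F A) (n : ℕ+) :
    endPerfectionEquiv hF ζ hζ hn (@Frobenioids.Perfection.mk _ (endCommMonoid F hF A) α n) =
      rootLevelHom hF ζ hζ n α := rfl

/-- "Determined by the natural functor `C → C^pf`": `endPerfectionEquiv` sends the class of `α ∈ O^▷(A)` to
the image of `α` in `C^pf`. [cite: MochizukiFrdI2008, Prop. 5.5 (i) p.104] -/
theorem endPerfectionEquiv_of (hn : IsFrobeniusNormalized F A) (α : endSubmonoid F A) :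
    (endPerfectionEquiv hF ζ hζ hn (@Frobenioids.Perfection.of _ (endCommMonoid F hF A) α)).1 =
      End.of ((toPf hF).map (End.asHom α.1)) :=
  rootLevelHom_one_coe hF ζ hζ α

/-- **Proposition 5.5 (i), Frobenius-trivial case** (print p. 104 ll. 46–48), for THE perfection
`PreFrobenioidData.perfection hF`: for a Frobenius-trivial, Frobenius-normalized object `A`, "the natural
functor `C → C^pf` determines a natural isomorphism `O^▷(A)^pf ⥲ O^▷(A^pf)`" — a multiplicative bijection
from the perfection of `O^▷(A)` onto `O^▷((A, 1))` sending the class of `α` to the image of `α`.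
[cite: MochizukiFrdI2008, Prop. 5.5 (i) p.104] -/
theorem prop55i_of_isFrobeniusTrivial (hF : IsFrobenioid F) {A : C} (hA : IsFrobeniusTrivial F A)
    (hn : IsFrobeniusNormalized F A) :
    ∃ e : @Frobenioids.Perfection (endSubmonoid F A) (endCommMonoid F hF A) ≃*
        (ops hF).endSubmonoid ((toPf hF).obj A),
      ∀ α : endSubmonoid F A,
        (e (@Frobenioids.Perfection.of _ (endCommMonoid F hF A) α)).1 = (toPf hF).map (End.asHom α.1) := by
  obtain ⟨ζ, hζ⟩ := hA
  exact ⟨endPerfectionEquiv hF ζ hζ hn, endPerfectionEquiv_of hF ζ hζ hn⟩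

end Perfection

end PreFrobenioid

end Literature.AlgebraicGeometry.Frobenioids
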